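import Mathlib.RingTheory.Norm.Basic
import Mathlib.RingTheory.AdjoinRoot
import Mathlib.LinearAlgebra.Matrix.Determinant.Basic
import HarnessLib

/-!
# Route `ByReductionTypeAtTwo`, crux `MultUpperHalfAtTwo` (item stmt-BirchSwinnertonDyer-19922), TOWER road, the
# «ONE BIT AT A NON-SPLIT 2» rows: KERNEL BRICK 1 — the norm principle for the binary form `x² − q y²`
# (norms from a finite extension `F/K` of elements represented by `⟨1, −q⟩` over `F` are represented
# by `⟨1, −q⟩` over `K`)

HONEST FRAMING (cell `bsd-2adic`, run/shared/lean/pub/bsd-2adic/, seat `bsd-2adic-tower-1` GEN 8, HUMAN RULINGS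
D-0036 / D-0054 / D-0074): TOOL theorems only (no definition, no named fact, no `sorry`); closes nothing by
itself; nothing booked; BSD is not proved by any of this. This is the first brick of the KERNELISATION of the
displayed MEMO binder `MultTowerNS2.localTowerKerTwoTorsion_le_two_nonsplitTwo_of_tateUnit`
(`Theorems/ByReductionTypeAtTwoMultTowerNS2OneBitDefs.lean`; cell memo HOME/mult2/gen7/PROOF-NS2ONE.md; kernel
scope HOME/tower/SCOPE-hNS2one-kernel-GEN8.md): the memo's steps (4)–(5) quote the Hilbert-symbol projection
formula `(q, δ)_F = (q, N_{F/ℚ₂} δ)_{ℚ₂}`, but the proof of «`#𝒦_{v,n}[2] ≤ 2` when `u_q ≡ ±3 (mod 8)`» uses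
only the implication «`q` is a norm from `F(√δ)` ⇒ `N_{F/K}(δ)` is a norm from `K(√q)`», which is the
elementary multiplicativity of norm forms proved here — no local class field theory, no Hilbert symbol.
General field theory (any characteristic where the hypotheses say so), stated for an arbitrary finite
extension `F/K`; the cell applies it to the layers `F = ℚ_{2,n}` of the local cyclotomic `ℤ₂`-tower over
`K = ℚ₂` with `δ = 2 + ζ_{2^{n+2}} + ζ_{2^{n+2}}⁻¹` (`N_{F/ℚ₂} δ = 2`) and `q` the Tate parameter.

* `exists_norm_sq_sub_algebraMap_eq` — for a field `K`, a commutative `K`-algebra `F`, free of finite rank,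
  `a ∈ F` and `q ∈ K`: `N_{F/K}(a² − q) = x² − q y²` for some `x, y ∈ K`. Proof (determinants,
  characteristic-free): with `A` the matrix of multiplication by `a`, `N(a² − q) = det(A² − q)`; over
  `R = K[θ]/(θ² − q)` one has `A² − q = (A + θ)(A − θ)`, `det(A + θ) = x + yθ` for some `x, y ∈ K`, and the
  `K`-endomorphism `θ ↦ −θ` of `R` gives `det(A − θ) = x − yθ`, whence `det(A² − q) = x² − q y²` in `R ⊇ K`.
* `exists_norm_sq_sub_mul_sq_eq` — `N_{F/K}(c² − q e²) = x² − q y²` (field `F`).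
* `exists_sq_sub_mul_sq_eq_norm_of_sq_sub_mul_sq_eq` — **the transfer**: if `a² − δ b² = q` with `a, b ∈ F`,
  `b ≠ 0` (i.e. `q` is a norm from `F[√δ]`), then `x² − q y² = N_{F/K}(δ)` for some `x, y ∈ K`;
  `…_of_two_ne_zero` — the same with `b = 0` allowed when `2 ≠ 0` in `K` and `q ≠ 0`.
* `sq_sub_mul_sq_ne_of_forall_ne_norm`, `not_isSquare_algebraMap_of_forall_ne_norm` — the contrapositives
  consumed downstream: if `N_{F/K}(δ)` is NOT of the form `x² − q y²` over `K`, then `q` is not of the form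
  `a² − δ b²` over `F`, and `q` is not a square in `F`.

In Hilbert-symbol language (`K` local): `(q, δ)_F = 1 ⇒ (q, N_{F/K} δ)_K = 1`, the "norm" half of the
projection formula (Serre, *Local Fields*, XIV; O'Meara 63:12); the statements here are purely algebraic.

References: J.-P. Serre, *Local Fields*, GTM 67, Ch. XIV (norm residue symbol); T. Y. Lam, *Introduction to
Quadratic Forms over Fields*, GSM 67 (2005), Ch. VII §5 (norm principles) — the binary case is the
multiplicativity of the norm form of `K[√q]`; cell memo PROOF-NS2ONE.md §4–§5.
-/

set_option autoImplicit false
-- the Theorems namespace of this sub repeats the summit name by design (D-0017 nested layout: Summit.<S>.<Sub>)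
set_option linter.dupNamespace false

noncomputable section

open Polynomial

namespace Summit.BirchSwinnertonDyer.BirchSwinnertonDyer.Theorems.MultTowerNS2

section Core

variable {K : Type*} [Field K] {F : Type*} [CommRing F] [Algebra K F] [Module.Free K F]
  [Module.Finite K F]

/-- **Norms of `a² − q` are of the form `x² − q y²`.** For a field `K`, a commutative `K`-algebra
`F` that is free of finite rank, `a ∈ F` and `q ∈ K`, there are `x, y ∈ K` with
`N_{F/K}(a² − q) = x² − q y²`. Determinant proof over `K[θ]/(θ² − q)`:
`N(a² − q) = det(A² − q) = det(A + θ) det(A − θ) = (x + yθ)(x − yθ)`, the second factor being the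
image of the first under `θ ↦ −θ`. Characteristic-free. [folklore] -/
theorem exists_norm_sq_sub_algebraMap_eq (a : F) (q : K) :
    ∃ x y : K, Algebra.norm K (a ^ 2 - algebraMap K F q) = x ^ 2 - q * y ^ 2 := by
  classical
  let ι := Module.Free.ChooseBasisIndex K F
  let b : Module.Basis ι K F := Module.Free.chooseBasis K F
  set A : Matrix ι ι K := Algebra.leftMulMatrix b a with hA
  -- `N(a² − q) = det (A² − q • 1)`
  have hN : Algebra.norm K (a ^ 2 - algebraMap K F q) = (A ^ 2 - q • (1 : Matrix ι ι K)).det := by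
    rw [Algebra.norm_eq_matrix_det b, map_sub, map_pow, AlgHom.commutes,
      Algebra.algebraMap_eq_smul_one]
  -- the quadratic algebra `R = K[X]/(X² − q)` with `θ² = q` and the automorphism `θ ↦ −θ`
  set m : K[X] := X ^ 2 - C q with hm_def
  have hm : m.Monic := monic_X_pow_sub_C q two_ne_zero
  have hmdeg : m.degree = 2 := by
    rw [hm_def]; exact degree_X_pow_sub_C (by norm_num) q
  haveI : Nontrivial (AdjoinRoot m) := AdjoinRoot.nontrivial m (by rw [hmdeg]; exact two_ne_zero)
  set θ : AdjoinRoot m := AdjoinRoot.root m with hθ_def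
  set ofK : K →+* AdjoinRoot m := AdjoinRoot.of m with hofK
  have hθ : θ ^ 2 = ofK q := by
    have h : eval₂ ofK θ (X ^ 2 - C q) = 0 := AdjoinRoot.eval₂_root m
    rw [eval₂_sub, eval₂_X_pow, eval₂_C, sub_eq_zero] at h
    exact h
  have hneg : eval₂ ofK (-θ) m = 0 := by
    change eval₂ ofK (-θ) (X ^ 2 - C q) = 0
    rw [eval₂_sub, eval₂_X_pow, eval₂_C, neg_sq, hθ, sub_self]
  let σ : AdjoinRoot m →+* AdjoinRoot m := AdjoinRoot.lift ofK (-θ) hneg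
  have hσof : ∀ x : K, σ (ofK x) = ofK x := fun x ↦ AdjoinRoot.lift_of hneg
  have hσθ : σ θ = -θ := AdjoinRoot.lift_root hneg
  -- the matrices `A ± θ` over `R`
  set Ao : Matrix ι ι (AdjoinRoot m) := ofK.mapMatrix A with hAo
  set Mp : Matrix ι ι (AdjoinRoot m) := Ao + θ • (1 : Matrix ι ι (AdjoinRoot m)) with hMp
  set Mm : Matrix ι ι (AdjoinRoot m) := Ao - θ • (1 : Matrix ι ι (AdjoinRoot m)) with hMm
  have hσM : σ.mapMatrix Mp = Mm := by
    ext i j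
    simp only [hMp, hMm, hAo, RingHom.mapMatrix_apply, Matrix.map_apply, Matrix.add_apply,
      Matrix.sub_apply, Matrix.smul_apply, Matrix.one_apply, smul_eq_mul, map_add, map_mul, hσof,
      hσθ]
    by_cases hij : i = j
    · simp only [if_pos hij, map_one]; ring
    · simp only [if_neg hij, map_zero]; ring
  have hprod : Mp * Mm = ofK.mapMatrix (A ^ 2 - q • (1 : Matrix ι ι K)) := by
    have h1 : Mp * Mm = Ao * Ao - (θ * θ) • (1 : Matrix ι ι (AdjoinRoot m)) := by
      rw [hMp, hMm, add_mul, mul_sub, mul_sub, Matrix.mul_smul, Matrix.smul_mul, mul_one, one_mul,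
        Matrix.smul_mul, one_mul, smul_smul]
      abel
    rw [h1, show θ * θ = ofK q by rw [← pow_two]; exact hθ, map_sub, map_pow, hAo, pow_two]
    congr 1
    ext i j
    by_cases hij : i = j
    · subst hij; simp [Matrix.smul_apply, RingHom.mapMatrix_apply, Matrix.map_apply]
    · simp [Matrix.smul_apply, RingHom.mapMatrix_apply, Matrix.map_apply, hij]
  -- `det (A + θ) = x + y θ`
  obtain ⟨P, hP⟩ := AdjoinRoot.mk_surjective (g := m) Mp.det
  set r : K[X] := P %ₘ m with hr_def
  have hrdeg : r.degree ≤ 1 := by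
    have hm1 : m ≠ 1 := by
      intro h1
      have := congrArg Polynomial.degree h1
      rw [hmdeg, degree_one] at this
      exact two_ne_zero this
    have hmnat : m.natDegree = 2 := natDegree_eq_of_degree_eq_some hmdeg
    have h := natDegree_modByMonic_lt P hm hm1
    rw [hmnat] at h
    exact degree_le_of_natDegree_le (Nat.lt_succ_iff.mp h)
  set x : K := r.coeff 0 with hx
  set y : K := r.coeff 1 with hy
  have hrXY : r = C y * X + C x := eq_X_add_C_of_degree_le_one hrdeg
  have hmkP : AdjoinRoot.mk m P = AdjoinRoot.mk m r := by
    rw [AdjoinRoot.mk_eq_mk]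
    refine ⟨P /ₘ m, ?_⟩
    have h := modByMonic_add_div P m
    rw [hr_def]
    linear_combination -h
  have hd : Mp.det = ofK x + ofK y * θ := by
    rw [← hP, hmkP, hrXY, map_add, map_mul, AdjoinRoot.mk_C, AdjoinRoot.mk_X, AdjoinRoot.mk_C]
    rw [hofK, hθ_def]; ring
  have hdσ : σ Mp.det = ofK x - ofK y * θ := by
    rw [hd, map_add, map_mul, hσof, hσof, hσθ]; ring
  -- the key identity in `R`
  have key : ofK (x ^ 2 - q * y ^ 2) = ofK ((A ^ 2 - q • (1 : Matrix ι ι K)).det) := by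
    calc ofK (x ^ 2 - q * y ^ 2)
        = (ofK x + ofK y * θ) * (ofK x - ofK y * θ) := by
          rw [map_sub, map_pow, map_mul, map_pow]
          have : (ofK x + ofK y * θ) * (ofK x - ofK y * θ) = ofK x ^ 2 - ofK y ^ 2 * θ ^ 2 := by
            ring
          rw [this, hθ]; ring
      _ = Mp.det * σ Mp.det := by rw [hdσ, hd]
      _ = Mp.det * Mm.det := by rw [RingHom.map_det, hσM]
      _ = (Mp * Mm).det := (Matrix.det_mul _ _).symm
      _ = (ofK.mapMatrix (A ^ 2 - q • (1 : Matrix ι ι K))).det := by rw [hprod]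
      _ = ofK ((A ^ 2 - q • (1 : Matrix ι ι K)).det) := (RingHom.map_det _ _).symm
  exact ⟨x, y, by rw [hN]; exact (ofK.injective key).symm⟩

end Core

section Field

variable {K : Type*} [Field K] {F : Type*} [Field F] [Algebra K F] [FiniteDimensional K F]

/-- **Norms of `c² − q e²` are of the form `x² − q y²`** (`F/K` a finite extension of fields,
`q ∈ K`): scale to `exists_norm_sq_sub_algebraMap_eq` by `e⁻¹` (`e ≠ 0`), or `y = 0` (`e = 0`).
[folklore] -/
theorem exists_norm_sq_sub_mul_sq_eq (c e : F) (q : K) :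
    ∃ x y : K, Algebra.norm K (c ^ 2 - algebraMap K F q * e ^ 2) = x ^ 2 - q * y ^ 2 := by
  by_cases he : e = 0
  · refine ⟨Algebra.norm K c, 0, ?_⟩
    rw [he]; simp [map_pow]
  · obtain ⟨x, y, hxy⟩ := exists_norm_sq_sub_algebraMap_eq (c / e) q
    refine ⟨Algebra.norm K e * x, Algebra.norm K e * y, ?_⟩
    have hce : c ^ 2 - algebraMap K F q * e ^ 2 = e ^ 2 * ((c / e) ^ 2 - algebraMap K F q) := by
      field_simp
    rw [hce, map_mul, map_pow, hxy]; ring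

/-- **The transfer («`q` a norm from `F[√δ]` ⇒ `N_{F/K} δ` a norm from `K[√q]`»).** If
`a² − δ b² = q` with `a, b ∈ F`, `b ≠ 0`, `q ∈ K`, then `x² − q y² = N_{F/K}(δ)` for some `x, y ∈ K`:
`δ = ((a/b)² − q (1/b)²)`, so `N(δ) = N(a² − q)/N(b)²`. Characteristic-free. In Hilbert-symbol terms
(local `K`): `(q, δ)_F = 1 ⇒ (q, N_{F/K} δ)_K = 1`, the norm direction of the projection formula.
[folklore] -/
theorem exists_sq_sub_mul_sq_eq_norm_of_sq_sub_mul_sq_eq {δ a b : F} {q : K} (hb : b ≠ 0)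
    (h : a ^ 2 - δ * b ^ 2 = algebraMap K F q) :
    ∃ x y : K, x ^ 2 - q * y ^ 2 = Algebra.norm K δ := by
  have hδ : δ = (a / b) ^ 2 - algebraMap K F q * (1 / b) ^ 2 := by
    rw [← h]; field_simp; ring
  obtain ⟨x, y, hxy⟩ := exists_norm_sq_sub_mul_sq_eq (a / b) (1 / b) q
  exact ⟨x, y, by rw [hδ, hxy]⟩

/-- **The transfer, `b = 0` allowed** (`2 ≠ 0` in `K`, `q ≠ 0`): if `a² − δ b² = q` with `a, b ∈ F`
then `x² − q y² = N_{F/K}(δ)` for some `x, y ∈ K`. When `b = 0`, `q = a²` is a nonzero square in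
`F` and `δ = ((δ + 1)/2)² − q ((δ − 1)/(2a))²`. (In characteristic `2` the clause `b = 0` fails:
`K = F = 𝔽₂(s)`, `q = 1`, `δ = s`.) [folklore] -/
theorem exists_sq_sub_mul_sq_eq_norm_of_sq_sub_mul_sq_eq_of_two_ne_zero {δ a b : F} {q : K}
    (h2 : (2 : K) ≠ 0) (hq : q ≠ 0) (h : a ^ 2 - δ * b ^ 2 = algebraMap K F q) :
    ∃ x y : K, x ^ 2 - q * y ^ 2 = Algebra.norm K δ := by
  by_cases hb : b = 0
  · have ha2 : a ^ 2 = algebraMap K F q := by rw [← h, hb]; ring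
    have ha : a ≠ 0 := by
      rintro rfl
      exact hq ((algebraMap K F).injective (by rw [← ha2, map_zero]; ring))
    have h2F : (2 : F) ≠ 0 := by
      have := (algebraMap K F).injective.ne h2
      rwa [map_ofNat, map_zero] at this
    have hδ : δ = ((δ + 1) / 2) ^ 2 - algebraMap K F q * ((δ - 1) / (2 * a)) ^ 2 := by
      rw [← ha2]; field_simp; ring
    obtain ⟨x, y, hxy⟩ := exists_norm_sq_sub_mul_sq_eq ((δ + 1) / 2) ((δ - 1) / (2 * a)) q
    exact ⟨x, y, by rw [hδ, hxy]⟩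
  · exact exists_sq_sub_mul_sq_eq_norm_of_sq_sub_mul_sq_eq hb h

/-- **Contrapositive (the form consumed downstream).** If `N_{F/K}(δ)` is not of the form
`x² − q y²` over `K` (`2 ≠ 0` in `K`, `q ≠ 0`), then `q` is not of the form `a² − δ b²` over `F` —
«`q` is not a norm from `F(√δ)`». [folklore] -/
theorem sq_sub_mul_sq_ne_of_forall_ne_norm {δ : F} {q : K} (h2 : (2 : K) ≠ 0) (hq : q ≠ 0)
    (hN : ∀ x y : K, x ^ 2 - q * y ^ 2 ≠ Algebra.norm K δ) (a b : F) :
    a ^ 2 - δ * b ^ 2 ≠ algebraMap K F q := fun h ↦ by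
  obtain ⟨x, y, hxy⟩ := exists_sq_sub_mul_sq_eq_norm_of_sq_sub_mul_sq_eq_of_two_ne_zero h2 hq h
  exact hN x y hxy

/-- **Contrapositive, square clause.** If SOME `δ ∈ F` has `N_{F/K}(δ)` not of the form `x² − q y²`
over `K` (`2 ≠ 0` in `K`, `q ≠ 0`), then `q` is not a square in `F` (a nonzero square `q = a²`
makes `x² − q y²` universal over `F ⊇ K(a)`, and norms from `K(a)` are of that form). [folklore] -/
theorem not_isSquare_algebraMap_of_forall_ne_norm {δ : F} {q : K} (h2 : (2 : K) ≠ 0) (hq : q ≠ 0)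
    (hN : ∀ x y : K, x ^ 2 - q * y ^ 2 ≠ Algebra.norm K δ) :
    ¬ IsSquare (algebraMap K F q) := by
  rintro ⟨a, ha⟩
  refine sq_sub_mul_sq_ne_of_forall_ne_norm h2 hq hN a 0 ?_
  rw [ha]; ring

end Field

end Summit.BirchSwinnertonDyer.BirchSwinnertonDyer.Theorems.MultTowerNS2

end
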